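import Summits.ABC.IUTFork.Repair.CandMochizuki32
import Summits.ABC.IUTFork.Repair.CandMochizuki6
import Summits.ABC.IUTFork.Cor312PinnedCountermodelLink
import HarnessLib

/-!
# REPAIR branch — ENGINE REQUEST E3 (rp-plan RULINGS #10 (3) / #11, GO w5-d098): the LABEL-DEPENDENT log-shell family
# `shellSettingDep p d⃗` with ONE (Ind3)-aware operator `rhoDep p d⃗` — profile, and the answer to «H′ ∧ honest-except-hscaled ∧ ¬S ?»

Model file (proof + toy data; no candidate, no `Prop` fact) of the abc-iut cell's IUT REPAIR branch (rung LADDER-ABC:A2.RP ⊆ A2.B;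
REPAIR-SPEC v0.3 §3 T-b PROFILE / T-c), seat abc-iut-w5-d098 (on-call kernel hand). TAKES NO SIDE between Mochizuki, Scholze–Stix or
anyone; nothing here asserts abc or [IUTchIII] Cor. 3.12 proved or refuted; models are TEST OBJECTS; typed ≠ proved; instantiated ≠
endorsed. Built BY NAME over abc-iut-w4-d103's `Cor312PinnedLogShell` / `Cor312PinnedLogShellOneRho` (`dilate`, `shellRegion`, `rhoOne`,
`thetaTypeData`; uniform inflation `d`) and abc-iut-w4-d101's `pinnedSetting` / `orbitRegion` / `qDatum`, zero edits; abc-iut-w5-d133's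
`Repair/ProfileHeight` (p429379) is label-UNIFORM in `d`, hence this file (rp-plan RULINGS #11). [claim: Mochizuki2012, status: disputed]

THE FAMILY. For an inflation VECTOR `d : Label → ℕ` (labels `0, 1, 2` of abc-iut-c312-7's one-place index, `l⋇ = 2`):
`shellSettingDep p d` := `pinnedSetting p` with the Θ-glue at label `j` dilated by `p^{−d j}` (so the Θ-pilot's Kummer image at label `j`
is `B_{j² − d j}`, the q-pilot's region `B_1` at `j = 1, 2` and `B_0` at the zero label, natural ball frame); `rhoDep p d` := the ONE
(Ind3)-aware equivariant operator reading Θ-type data through the log-shell `𝓘_{d j}` at label `j` and other data holomorphically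
(`rhoOne p (d j)` at label `j`). `d ≡ d₀` recovers `shellSetting p d₀` / `rhoOne p d₀` AT EVERY LABEL (`rfl` pointwise).

PROFILE (kernel, every `p`, every `d⃗`; §§2–5). Typed Thm 3.11 (`naiveFull_statement`), `BridgeHyps`, `|log q| > 0`, the THREE PINS for
`(rhoDep d⃗, qDatum)`, Step (x) `hAdm`/`hvol`, admissible (Ind3)-regions, LABEL-INDEPENDENT q-volume hold for EVERY `d⃗`; and
* typed Corollary `Statement ↔ 3 ≤ d 1 + d 2` · (xi-f) `Licence ↔ GapH3 ↔ 3 ≤ d 2` · M36c (`CandMochizuki6.H''`, packetwise volume) `↔ 3 ≤ d 2`;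
* honest `j²`-scaling at label `j ∈ {1,2}` `↔ d j = 0`;
* **residual `S = PilotKummerIndRelated ↔ d 0 = 0 ∧ d 1 = 0 ∧ d 2 = 3`** (= Reading R3 at ALL labels = rp-m3's region-level `H`);
* **M32b `H′` (volume level) `↔ d 1 = 0 ∧ d 2 = 3`** — NO condition at the zero label.

THE E3 ANSWER (§6). (a) `E3_residual_witness`: at `d⃗⋆ = (0, 0, 3)` (= `j² − 1` on `𝔽_l^⋇`, `0` at the zero label) typed Thm 3.11 ∧ BridgeHyps ∧
AbsLogQPos ∧ PinnedRegions3 ∧ Step (x) ∧ admissible (Ind3)-regions ∧ hindep ∧ `H′` ∧ `H` ∧ **S** ∧ Licence ∧ Statement ALL HOLD for the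
NON-identified datum `qDatum` (`≠ Ψ`), violating EXACTLY ONE honesty clause: `hscaled` at label `2` (there `logvol ρ(Ψ) = −log p = qLocal`,
not `4·qLocal`). So the volume-level rows have a **SAT[ρ, label-dependent (Ind3)] witness — but it is a witness for the RESIDUAL ITSELF**
((Ind)-trivial class of abc-iut-w5-d068's PROFILE v0.4: the indeterminacy group fixes every ball), not a separator of `H′` from S.
(b) `E3_no_honest_separation` / `dep_H'_and_not_S_iff`: on the whole family `H′ ∧ ¬S ↔ (d 1 = 0 ∧ d 2 = 3 ∧ d 0 ≠ 0)` — the ONLY way to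
hold `H′` and refute S here is to inflate the ZERO label (`E3_zero_label_artefact` at `(1, 0, 3)`: S fails at `j = 0` only, where neither
`H′`, nor the Licence, nor the typed Corollary reads anything). READING (neutral, for rp-plan / rp-bar): genuinely separating volume
identity from region identification at the labels that carry volume needs a carrier on which log-volume does not determine the
admissible region (abc-iut-w4-d021's SEPVOL class; cf. `CandMochizuki32Tests.volumePinned_iff_residual_of_injective` p429495); the
typed residual is ZERO-LABEL-SENSITIVE (it constrains `j = 0`, the Statement does not) — recorded, no opinion.
-/

noncomputable section

open Set

namespace Summit.ABC.IUTFork.Repair.ModelShellDep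

open Thm311 Cor312 Cor312.Checks Cor312.IdentifiedNonVacuity Cor312Vol Cor312Vol.NaiveWitness Cor312Vol.PinnedWitness
  Cor312Vol.PinnedHonest Literature.IUT.LogThetaLattice
open Summit.ABC.IUTFork.Repair.CandMochizuki32

variable (p : ℕ) (d : toyIndex.Label → ℕ)

/-! ## 1. The family and its one operator -/

/-- **`shellSettingDep p d⃗`**: abc-iut-w4-d101's `pinnedSetting p` with the Θ-glue at label `j` dilated by `p^{−d j}` (abc-iut-w4-d103's
`dilate`); every other field verbatim. `d ≡ d₀` gives `shellSetting p d₀`'s fields. Toy DATA. [claim: Mochizuki2012, status: disputed] -/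
def shellSettingDep : Setting (naiveSituation p) :=
  { pinnedSetting p with thetaRegionOf := fun m k j vQ => dilate p (d j) j vQ ((pinnedSetting p).thetaRegionOf m k j vQ) }

open Classical in
/-- **`rhoDep p d⃗`** — ONE equivariant operator for both pilots: at label `j` it is abc-iut-w4-d103's `rhoOne p (d j)` (log-shell reading
`X ↦ X_j·𝓘_{d j}` on Θ-type data, holomorphic reading `X ↦ X_j·𝒪` otherwise). Toy DATA. [claim: Mochizuki2012, status: disputed] -/
def rhoDep (X : ∀ v : toyIndex.V, v ∈ toyIndex.Vbad → Set (signShells.StarPacket v)) (j : toyIndex.Label) (vQ : toyIndex.VQ) :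
    Set (signShells.Packet j vQ) :=
  rhoOne p (d j) X j vQ

/-- At each label the operator IS `rhoOne` with that label's inflation. [folklore] -/
theorem rhoDep_apply (X : ∀ v : toyIndex.V, v ∈ toyIndex.Vbad → Set (signShells.StarPacket v)) (j : toyIndex.Label) (vQ : toyIndex.VQ) :
    rhoDep p d X j vQ = rhoOne p (d j) X j vQ := rfl

/-- **EQUIVARIANCE (hρ)** of `rhoDep` under the whole ⟨(Ind1) ∪ (Ind2)⟩ (labelwise from `rhoOne_equivariant`). [folklore] -/
theorem rhoDep_equivariant {Φ : signShells.PacketAut}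
    (hΦ : Φ ∈ Subgroup.closure (signShells.Ind1Family ∪ signShells.Ind2Family))
    (X : ∀ v : toyIndex.V, v ∈ toyIndex.Vbad → Set (signShells.StarPacket v)) (j : toyIndex.Label) (vQ : toyIndex.VQ) :
    rhoDep p d (fun v hv => signShells.starAut Φ v '' X v hv) j vQ = Φ j vQ '' rhoDep p d X j vQ :=
  rhoOne_equivariant p (d j) hΦ X j vQ

variable [hp : Fact p.Prime]

/-- On the Θ-monoid: `B_{j² − d j}`. [folklore] -/
theorem rhoDep_Psi (j : toyIndex.Label) (vQ : toyIndex.VQ) : rhoDep p d (fun v _ => Psi p v) j vQ = pBall p j vQ (jsq j - d j) := by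
  rw [rhoDep_apply, rhoOne_Psi, shellRegion_Psi]

/-- On the q-datum: the holomorphic reading (`B_1` at `j = 1, 2`, `𝒪` at the zero label). [folklore] -/
theorem rhoDep_qDatum (j : toyIndex.Label) (vQ : toyIndex.VQ) : rhoDep p d (qDatum p) j vQ = orbitRegion p (qDatum p) j vQ := by
  rw [rhoDep_apply, rhoOne_qDatum]

omit hp in
/-- The Θ-pilot object is the lgp-object of exponent `1`. [folklore] -/
theorem dep_thetaPilot : (shellSettingDep p d).thetaPilot = (1 : ℤ) := pinSetting_thetaPilot p

/-- The `(n,m)`-Kummer image of the Θ-pilot object at label `j` is `B_{j² − d j}`. [folklore] -/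
theorem dep_thetaRegion (m : ℤ) (j : toyIndex.Label) (vQ : toyIndex.VQ) :
    (shellSettingDep p d).thetaRegion m j vQ = pBall p j vQ (jsq j - d j) := by
  show dilate p (d j) j vQ ((pinnedSetting p).thetaRegionOf m (shellSettingDep p d).thetaPilot j vQ) = _
  rw [dep_thetaPilot]
  show dilate p (d j) j vQ (pBall p j vQ ((1 : ℤ) * jsq j)) = _
  rw [one_mul, dilate_pBall]

omit hp in
/-- The q-side is that of `pinnedSetting` (verbatim fields). [folklore] -/
theorem dep_qRegion_eq : (shellSettingDep p d).qRegion = (pinnedSetting p).qRegion := rfl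

/-- The (Ind3)-enlarged Θ-region at label `j` is `B_{j² − d j}`. [folklore] -/
theorem dep_thetaRegion3 (j : toyIndex.Label) (vQ : toyIndex.VQ) : (shellSettingDep p d).thetaRegion3 j vQ = pBall p j vQ (jsq j - d j) := by
  show (⋃ m : ℤ, (shellSettingDep p d).thetaRegion m j vQ) = _
  simp_rw [dep_thetaRegion]
  exact Set.iUnion_const _

/-- The possible images at label `j` are `{B_{j² − d j}}` (the indeterminacies fix every ball: (Ind)-TRIVIAL family). [folklore] -/
theorem dep_possibleImages (j : toyIndex.Label) (vQ : toyIndex.VQ) :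
    (shellSettingDep p d).possibleImages j vQ = {pBall p j vQ (jsq j - d j)} := by
  ext U
  constructor
  · rintro ⟨Φ, hΦ, rfl⟩
    rw [dep_thetaRegion3, Set.mem_singleton_iff]
    exact image_pBall_of_mem_closure p hΦ j vQ _
  · rintro rfl
    rw [← dep_thetaRegion3]
    exact (shellSettingDep p d).thetaRegion3_mem_possibleImages j vQ

/-- The packet hull is `B_{j² − d j}` and is defined. [folklore] -/
theorem dep_thetaHull (j : toyIndex.Label) (vQ : toyIndex.VQ) :
    (shellSettingDep p d).thetaHull j vQ = pBall p j vQ (jsq j - d j) ∧ (shellSettingDep p d).HullDefined j vQ := by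
  have hU : ⋃₀ (shellSettingDep p d).possibleImages j vQ = pBall p j vQ (jsq j - d j) := by
    rw [dep_possibleImages, Set.sUnion_singleton]
  refine ⟨?_, ?_⟩
  · unfold Setting.thetaHull; rw [hU]; exact pFrame_hull_pBall p j vQ _
  · unfold Setting.HullDefined; rw [hU]; exact pFrame_bounded_hasHull p j vQ _

/-- The local Θ-term at label `j` is `−(j² − d j)·log p`. [folklore] -/
theorem dep_thetaLocal (j : toyIndex.Label) (vQ : toyIndex.VQ) :
    (shellSettingDep p d).thetaLocal j vQ = ((-((jsq j - d j : ℤ) : ℝ) * Real.log p : ℝ) : WithTop ℝ) := by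
  unfold Setting.thetaLocal
  rw [if_pos (dep_thetaHull p d j vQ).2, (dep_thetaHull p d j vQ).1]
  show ((pVol p j vQ (pBall p j vQ (jsq j - d j)) : ℝ) : WithTop ℝ) = _
  rw [pVol_pBall]

/-- `−|log(Θ)|` is finite. [folklore] -/
theorem dep_thetaFinite : (shellSettingDep p d).ThetaFinite :=
  ⟨fun i vQ => by rw [dep_thetaLocal]; exact WithTop.coe_ne_top, fun _ => Set.toFinite _⟩

omit hp d in
/-- Bookkeeping: `labelSucc 0 = 1`, `labelSucc 1 = 2` in `𝔽_l^⋇ = {1, 2}`. [folklore] -/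
theorem labelSucc_fin_zero : Setting.labelSucc (T := toyIndex) ⟨0, by decide⟩ = 1 := by decide

omit hp d in
/-- Bookkeeping: `labelSucc 1 = 2`. [folklore] -/
theorem labelSucc_fin_one : Setting.labelSucc (T := toyIndex) ⟨1, by decide⟩ = 2 := by decide

omit hp d in
/-- Enumeration of `Fin l⋇ = Fin 2`. [folklore] -/
theorem labelFin_cases (i : Fin toyIndex.lstar) : i = ⟨0, by decide⟩ ∨ i = ⟨1, by decide⟩ := by revert i; decide

omit hp d in
/-- `∀ i : Fin l⋇` as a conjunction. [folklore] -/
theorem forall_labelFin_iff (Q : Fin toyIndex.lstar → Prop) : (∀ i, Q i) ↔ Q ⟨0, by decide⟩ ∧ Q ⟨1, by decide⟩ :=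
  ⟨fun h => ⟨h _, h _⟩, fun h i => by rcases labelFin_cases i with rfl | rfl <;> [exact h.1; exact h.2]⟩

/-- **`−|log(Θ)| = ((d 1 + d 2 − 5)/2)·log p`** (average over `j ∈ {1,2}` of `−(j² − d j)·log p`). [folklore] -/
theorem dep_negLogTheta :
    (shellSettingDep p d).negLogTheta = (((((d 1 : ℝ) + d 2) - 5) / 2 * Real.log p : ℝ) : WithTop ℝ) := by
  rw [(shellSettingDep p d).negLogTheta_eq_of_thetaFinite (dep_thetaFinite p d)]
  congr 1
  have h : (fun i : Fin toyIndex.lstar => ∑ᶠ vQ : toyIndex.VQ, ((shellSettingDep p d).thetaLocal (Setting.labelSucc i) vQ).untopD 0) =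
      fun i : Fin toyIndex.lstar => -((jsq (Setting.labelSucc i) - d (Setting.labelSucc i) : ℤ) : ℝ) * Real.log p := by
    funext i
    simp only [dep_thetaLocal, finsum_unique, WithTop.untopD_coe]
  rw [h]
  have h1 : jsq (Setting.labelSucc (T := toyIndex) ⟨0, by decide⟩) = 1 := by decide
  have h2 : jsq (Setting.labelSucc (T := toyIndex) ⟨1, by decide⟩) = 4 := by decide
  show (∑ i : Fin 2, -((jsq (Setting.labelSucc i) - d (Setting.labelSucc i) : ℤ) : ℝ) * Real.log p) / ((2 : ℕ) : ℝ) = _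
  rw [Fin.sum_univ_two]
  change (-((jsq (Setting.labelSucc (T := toyIndex) ⟨0, by decide⟩) - d (Setting.labelSucc (T := toyIndex) ⟨0, by decide⟩) : ℤ) : ℝ) *
      Real.log p +
    -((jsq (Setting.labelSucc (T := toyIndex) ⟨1, by decide⟩) - d (Setting.labelSucc (T := toyIndex) ⟨1, by decide⟩) : ℤ) : ℝ) *
      Real.log p) / ((2 : ℕ) : ℝ) = _
  rw [h1, h2, labelSucc_fin_zero, labelSucc_fin_one]
  push_cast
  ring

/-- `−|log(q)| = −log p` (q-side of `pinnedSetting`). [folklore] -/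
theorem dep_negLogQ : (shellSettingDep p d).negLogQ = -Real.log p := pinnedSetting_negLogQ p

/-- `|log(q)| > 0`. [folklore] -/
theorem dep_absLogQPos : (shellSettingDep p d).AbsLogQPos := pinnedSetting_absLogQPos p

/-! ## 2. The typed Corollary, the Licence and M36c on the family -/

/-- **The typed Corollary 3.12 at `shellSettingDep p d⃗` is `3 ≤ d 1 + d 2`** (`−log p ≤ ((d 1 + d 2 − 5)/2)·log p`). [folklore] -/
theorem dep_statement_iff : Summit.ABC.IUTFork.Cor312.Setting.Statement (shellSettingDep p d) ↔ 3 ≤ d 1 + d 2 := by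
  have hl := log_p_pos p
  unfold Setting.Statement
  rw [dep_negLogTheta, dep_negLogQ, WithTop.coe_le_coe]
  constructor
  · rintro ⟨-, h⟩
    have h' : (3 : ℝ) ≤ (d 1 : ℝ) + d 2 := by nlinarith
    exact_mod_cast h'
  · intro h
    refine ⟨WithTop.coe_ne_top, ?_⟩
    have h' : (3 : ℝ) ≤ (d 1 : ℝ) + (d 2 : ℝ) := by exact_mod_cast h
    nlinarith

omit hp in
/-- The q-pilot region at a label of `𝔽_l^⋇` is `B_1`. [folklore] -/
theorem dep_qRegion_labelSucc (i : Fin toyIndex.lstar) (vQ : toyIndex.VQ) :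
    (shellSettingDep p d).qRegion (Setting.labelSucc i) vQ = pBall p _ vQ 1 :=
  pinnedSetting_qRegion_of_ne_zero p (Setting.labelSucc_ne_zero _) vQ

/-- **The (xi-f) Licence at `shellSettingDep p d⃗` is `3 ≤ d 2`** (`B_1 ⊆ B_{1 − d 1}` always; `B_1 ⊆ B_{4 − d 2}` iff `d 2 ≥ 3`). [folklore] -/
theorem dep_licence_iff : Thm311ToCor312.Licence (shellSettingDep p d) ↔ 3 ≤ d 2 := by
  constructor
  · intro hL
    have h := hL ⟨1, by decide⟩ ()
    rw [(dep_thetaHull p d _ ()).1, dep_qRegion_labelSucc, pBall_subset_iff, labelSucc_fin_one] at h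
    have h2 : jsq (2 : toyIndex.Label) = 4 := by decide
    rw [h2] at h
    omega
  · intro hd i vQ
    rw [(dep_thetaHull p d _ vQ).1, dep_qRegion_labelSucc, pBall_subset_iff]
    rcases labelFin_cases i with rfl | rfl
    · rw [labelSucc_fin_zero]; have : jsq (1 : toyIndex.Label) = 1 := by decide
      rw [this]; omega
    · rw [labelSucc_fin_one]; have : jsq (2 : toyIndex.Label) = 4 := by decide
      rw [this]; omega

/-- **M36c on the family**: rp-m2's packetwise volume reading `CandMochizuki6.H''` («q-volume ≤ hull volume in every packet») holds IFF
`3 ≤ d 2` — the same threshold as the Licence. [claim: Mochizuki2012, status: disputed] -/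
theorem dep_M36c_iff : CandMochizuki6.H'' (naiveFull p).toLatticeSituation (shellSettingDep p d) ↔ 3 ≤ d 2 := by
  have hl := log_p_pos p
  have hq : ∀ (i : Fin toyIndex.lstar) (vQ : toyIndex.VQ), (shellSettingDep p d).qLocal (Setting.labelSucc i) vQ = -Real.log p := by
    intro i vQ
    unfold Setting.qLocal
    rw [dep_qRegion_labelSucc]
    show pVol p _ vQ (pBall p _ vQ 1) = _
    rw [pVol_pBall]; push_cast; ring
  constructor
  · intro h
    have h2 := h ⟨1, by decide⟩ ()
    rw [hq, dep_thetaLocal, WithTop.untopD_coe, labelSucc_fin_one] at h2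
    have e4 : jsq (2 : toyIndex.Label) = 4 := by decide
    rw [e4] at h2
    have : ((4 - (d 2 : ℤ) : ℤ) : ℝ) ≤ 1 := by
      have h3 : -Real.log p ≤ -(((4 : ℤ) - (d 2 : ℤ) : ℤ) : ℝ) * Real.log p := h2
      nlinarith
    have : (4 : ℤ) - d 2 ≤ 1 := by exact_mod_cast this
    omega
  · intro hd i vQ
    rw [hq, dep_thetaLocal, WithTop.untopD_coe]
    have : ((jsq (Setting.labelSucc i) - d (Setting.labelSucc i) : ℤ) : ℝ) ≤ 1 := by
      rcases labelFin_cases i with rfl | rfl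
      · rw [labelSucc_fin_zero]; have : jsq (1 : toyIndex.Label) = 1 := by decide
        rw [this]; push_cast; linarith [(Nat.cast_nonneg (d 1) : (0 : ℝ) ≤ d 1)]
      · rw [labelSucc_fin_one]; have : jsq (2 : toyIndex.Label) = 4 := by decide
        rw [this]; have : (3 : ℝ) ≤ d 2 := by exact_mod_cast hd
        push_cast; linarith
    nlinarith

/-! ## 3. Bridge hypotheses, Step (x), honesty clauses -/

/-- Every bridge hypothesis of abc-iut-c312-6 holds on the family. [folklore] -/
theorem dep_bridgeHyps : BridgeHyps (shellSettingDep p d) where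
  mono := (pinnedSetting_bridgeHyps p).mono
  image_adm := fun i vQ U hU => ⟨jsq _ - d _, by rw [dep_possibleImages, Set.mem_singleton_iff] at hU; exact hU⟩
  image_fin := fun _ => Set.toFinite _
  hul_nonempty := (pinnedSetting_bridgeHyps p).hul_nonempty
  theta_nonempty := fun i vQ => by rw [dep_thetaRegion3]; exact ⟨0, zero_mem_pBall p _ vQ _⟩
  finite := dep_thetaFinite p d

omit hp in
/-- Step (x), admissibility clause (the naive data; setting-independent). [folklore] -/
theorem dep_adm_iff_image :
    ∀ Φ ∈ signShells.Ind1Family ∪ signShells.Ind2Family, ∀ (j : toyIndex.Label) (vQ : toyIndex.VQ) (B : Set (signShells.Packet j vQ)),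
      ((naiveFull p).toLatticeSituation.D (shellSettingDep p d).n).Adm j vQ B ↔
        ((naiveFull p).toLatticeSituation.D (shellSettingDep p d).n).Adm j vQ (Φ j vQ '' B) :=
  naiveData_adm_iff_image p

omit hp in
/-- Step (x), volume clause. [folklore] -/
theorem dep_logvolInvariant : ((naiveFull p).toLatticeSituation.D (shellSettingDep p d).n).LogvolInvariant :=
  naiveData_logvolInvariant p

/-- The (Ind3)-enlarged Θ-regions are admissible. [folklore] -/
theorem dep_thetaRegion3_adm (j : toyIndex.Label) (vQ : toyIndex.VQ) :
    ((naiveFull p).toLatticeSituation.D (shellSettingDep p d).n).Adm j vQ ((shellSettingDep p d).thetaRegion3 j vQ) :=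
  ⟨jsq j - d j, dep_thetaRegion3 p d j vQ⟩

/-- The local q-term is `−log p` at every label of `𝔽_l^⋇`. [folklore] -/
theorem dep_qLocal (i : Fin toyIndex.lstar) (vQ : toyIndex.VQ) :
    (shellSettingDep p d).qLocal (Setting.labelSucc i) vQ = -Real.log p := by
  unfold Setting.qLocal
  rw [dep_qRegion_labelSucc]
  show pVol p _ vQ (pBall p _ vQ 1) = _
  rw [pVol_pBall]; push_cast; ring

/-- **LABEL-INDEPENDENT q-VOLUME holds on the family** (honesty clause `hindep`). [folklore] -/
theorem dep_qLocal_indep (i i' : Fin toyIndex.lstar) (vQ : toyIndex.VQ) :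
    (shellSettingDep p d).qLocal (Setting.labelSucc i) vQ = (shellSettingDep p d).qLocal (Setting.labelSucc i') vQ := by
  rw [dep_qLocal, dep_qLocal]

/-- **HONEST `j²`-SCALING at label `j = i + 1` holds IFF `d j = 0`** (`logvol ρ(Ψ)_j = −(j² − d j)·log p` vs `j²·qLocal_j = −j²·log p`).
[folklore] -/
theorem dep_hscaled_iff (i : Fin toyIndex.lstar) (vQ : toyIndex.VQ) :
    ((naiveFull p).toLatticeSituation.D (shellSettingDep p d).n).logvol _ vQ
        (rhoDep p d ((naiveFull p).toLatticeSituation.D (shellSettingDep p d).n).Ψ (Setting.labelSucc i) vQ) =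
      (((i : ℕ) + 1 : ℕ) : ℝ) ^ 2 * (shellSettingDep p d).qLocal (Setting.labelSucc i) vQ ↔
    d (Setting.labelSucc i) = 0 := by
  have hl := log_p_pos p
  have hΨ : ((naiveFull p).toLatticeSituation.D (shellSettingDep p d).n).Ψ = fun v _ => Psi p v := rfl
  rw [hΨ, rhoDep_Psi, dep_qLocal]
  show pVol p _ vQ (pBall p _ vQ (jsq (Setting.labelSucc i) - d (Setting.labelSucc i))) = _ ↔ _
  rw [pVol_pBall]
  have hj : (jsq (Setting.labelSucc i) : ℝ) = (((i : ℕ) + 1 : ℕ) : ℝ) ^ 2 := by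
    unfold jsq Setting.labelSucc
    push_cast
    simp [Fin.val_succ]
  constructor
  · intro h
    have h2 : ((jsq (Setting.labelSucc i) - d (Setting.labelSucc i) : ℤ) : ℝ) * Real.log p =
        (((i : ℕ) + 1 : ℕ) : ℝ) ^ 2 * Real.log p := by linear_combination (-1 : ℝ) * h
    have h3 : ((jsq (Setting.labelSucc i) - d (Setting.labelSucc i) : ℤ) : ℝ) = (((i : ℕ) + 1 : ℕ) : ℝ) ^ 2 :=
      mul_right_cancel₀ hl.ne' h2
    rw [← hj] at h3
    push_cast at h3
    have h4 : ((d (Setting.labelSucc i) : ℕ) : ℝ) = 0 := by linarith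
    exact_mod_cast h4
  · intro h
    rw [h, ← hj]; push_cast; ring

/-! ## 4. The three pins for `(rhoDep d⃗, qDatum)` — every `d⃗` -/

/-- **(hρ) ∧ (pΘ)** for `rhoDep d⃗`. [claim: Mochizuki2012, status: disputed] -/
theorem dep_thetaPinned : ThetaPinned (naiveFull p).toLatticeSituation (shellSettingDep p d) (rhoDep p d) := by
  refine ⟨fun Φ hΦ X j vQ => rhoDep_equivariant p d hΦ X j vQ, fun m j vQ => ?_⟩
  have hΨ : ((naiveFull p).col (shellSettingDep p d).n).frobΨ m = fun v _ => Psi p v := by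
    funext v hv
    exact image_Psi_of_actsBySigns p (twist_actsBySigns m) v
  rw [hΨ, rhoDep_Psi, dep_thetaRegion]

/-- **(pq′)** for the SAME operator and the computed q-datum. [claim: Mochizuki2012, status: disputed] -/
theorem dep_qPinned : QPinned (naiveFull p).toLatticeSituation (shellSettingDep p d) (rhoDep p d) (qDatum p) := fun j vQ => by
  rw [rhoDep_qDatum]
  exact pinnedSetting_qPinned p j vQ

omit hp in
/-- (pL): the link pin (objects as for `pinnedSetting`). [folklore] -/
theorem dep_linkPinned : LinkPinned (naiveFull p).toLatticeSituation (shellSettingDep p d) := pinnedSetting_pilotLink p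

/-- **The THREE PINS hold on the whole family.** [claim: Mochizuki2012, status: disputed] -/
theorem dep_pinnedRegions3 : PinnedRegions3 (naiveFull p).toLatticeSituation (shellSettingDep p d) (rhoDep p d) (qDatum p) :=
  ⟨⟨dep_thetaPinned p d, dep_qPinned p d⟩, dep_linkPinned p d⟩

end Summit.ABC.IUTFork.Repair.ModelShellDep

end
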